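import Literature.IUT.HodgeTheaters.GlobalFrobenioidsCoricModel
import HarnessLib

/-!
# [IUTchI] Example 5.1 (v), pp. 127–128: a KIT for inhabiting the Kummer-rigidity LAW BINDERS of the layer-5
# certificate row `IUTchI:Ex5.1(v)` at pairs of the shape "fixed multiplicative ray ∪ one permuted orbit"
# (proof-only; generic lemmas, no model yet)

S. Mochizuki, *Inter-universal Teichmüller theory I*, kurims manuscript (May 2020), §5 Example 5.1 (v), p. 127
l. 13 – p. 128 l. 54 ([IUTchI] Ex 5.1 (v) pp.127–128) [claim: Mochizuki2012, status: disputed] (D-0012 claim key;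
nothing disputed is asserted; no side is taken on [IUTchIII] Cor. 3.12).

Cell abc-iut, sub-DAG `plan/L5/SUBDAG-IUTchI-Ex51.md` rows E51/L23, E51/L27, E51/L29; layer-5 certificate additive
module `Summits/ABC/IUTFork/Conditional/Layer5OfSEx51.lean`, theorem `layer5_held_ex51v` (row 1116), whose
N-side LAW BINDERS are: F-2571 `MκIsInvariants`; (a)/(a×) Kummer naturality `h_Ex51v_nat(x)` ("every automorphism
of the model pair multiplies Kummer classes by a unit of `Ẑ`"); (b′)/(b′×) divisor transport `h_Ex51v_ord(x)`;
Rmk 3.1.7 (i)/(ii) pole/zero shape; and `h_Ex51v_moves` (some element of `π₁^{rat/κ-sol}(†𝒟^⊛)` MOVES an ∞κ×-coric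
function).  abc-iut-w5-d110 proved (`GlobalFrobenioidsCoricRigidityLawsCentral.lean`, p432142) that this binder set
has NO model in which `π₁^rat(†𝒟^⊛)` is commutative.  The companion file `GlobalFrobenioidsCoricLawsNonVacuity.lean`
(abc-iut-w4-d050) inhabits the whole N-side block at ONE datum with NON-ABELIAN `π₁^rat := S₃`; the present file is
its model-independent kit, for an interface datum `N : NFBridgeRecon` and a `π₁^rat`-stable set `S ⊆ K_rat` of the
shape

  `S = {c 0, c 1, c 2, …} ∪ {x i | i : ι}`,  `c` a FIXED multiplicative ray (`c a · c b = c (a + b)`, `g • c n = c n`),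
  `x` ONE `π₁^rat`-orbit-like family permuted through `ρ : π₁^rat → Perm ι` (`g • x i = x (ρ g i)`) whose point
  stabilisers are "self-normalising" (`hmove`: for `i ≠ j` some `g` fixes `i` and moves `j`), with no products
  `c n · x i` (`n ≥ 1`) or `x i · x j` inside `S`:

* `NFBridgeRecon.CoricLawsToy.exists_eq_c_of_fixed` — the `π₁^rat`-FIXED elements of `S` are exactly the ray;
* `NFBridgeRecon.CoricLawsToy.iso_apply_eq_self` — **the pair `π₁^rat ↷ S` ([IUTchI] §0 pseudo-monoid + action,
  `coricPairOfSubset`) has NO automorphism other than the identity**: an automorphism (equivariant, respecting the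
  partial multiplication) fixes `c 0 = 1` (idempotent), maps the generator `c 1` to a fixed element `c k`, hence
  `c n ↦ c (k n)`, and surjectivity onto `c 1` forces `k = 1`; on the orbit, equivariance plus `hmove` forces
  `x i ↦ x i` — so the naturality binders (a)/(a×) hold there with the unit `u := 1`;
* `NFBridgeRecon.CoricLawsToy.exists_kummerRealization` — a Kummer realisation ([IUTchI] §0 "realises the
  pseudo-monoid structure", `CoricPair.KummerRealization`) of such a pair in ANY `π₁^rat`-module `H` carrying an
  injective additive ray `z : ℕ → H` (fixed) and an injective equivariant family `v : ι → H` with the same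
  product-exclusion pattern, with the SPECIFICATION `κ(c n) = z n`, `κ(x i) = v i`.

HONEST FRAMING.  Elementary bookkeeping about toy pairs; a toy inhabits ASSUMPTION LABELS of OUR certificate and
asserts nothing of [IUTchI]; typed ≠ proved; no side is taken on [IUTchIII] Cor. 3.12.  PROOF-ONLY: no `def`, no
`instance`, no `structure`, no new Prop fact.
-/

namespace Literature.IUT.HodgeTheaters

namespace NFBridgeRecon

namespace CoricLawsToy

variable {N : NFBridgeRecon.{0}} {ι : Type} {S : Set N.Krat}
  (hS : ∀ (g : N.piRat) {f : N.Krat}, f ∈ S → g • f ∈ S)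
  (c : ℕ → N.Krat) (x : ι → N.Krat) (ρ : N.piRat →* Equiv.Perm ι)

/-- In a set `S = {c n} ∪ {x i}` whose ray `c` is fixed and whose family `x` is permuted by `π₁^rat` with every
index moved by someone (`hmv`), the `π₁^rat`-FIXED elements are exactly the `c n`.
([IUTchI] Ex 5.1 (v) p.127) [claim: Mochizuki2012, status: disputed] -/
theorem exists_eq_c_of_fixed (hM : ∀ f, f ∈ S ↔ (∃ n, f = c n) ∨ ∃ i, f = x i)
    (hx : Function.Injective x) (hsx : ∀ (g : N.piRat) (i : ι), g • x i = x (ρ g i))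
    (hmv : ∀ i : ι, ∃ g : N.piRat, ρ g i ≠ i) {f : N.Krat} (hf : f ∈ S)
    (hfix : ∀ g : N.piRat, g • f = f) : ∃ n, f = c n := by
  rcases (hM f).1 hf with ⟨n, rfl⟩ | ⟨i, rfl⟩
  · exact ⟨n, rfl⟩
  · obtain ⟨g, hg⟩ := hmv i
    exact absurd (hx ((hsx g i).symm.trans (hfix g))) hg

/-- **Automorphisms of the pair `π₁^rat ↷ S` are trivial** for `S` of the shape "fixed multiplicative ray `c` ∪ one
permuted family `x` with self-normalising stabilisers and no mixed products": every `CoricPair.Iso` of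
`coricPairOfSubset S` with itself is the identity on the nose.  This is the form in which the Kummer-naturality
binders (a)/(a×) of the layer-5 certificate row `IUTchI:Ex5.1(v)` are inhabited (with the unit `u := 1`).
([IUTchI] Ex 5.1 (v) pp.127–128) [claim: Mochizuki2012, status: disputed] -/
theorem iso_apply_eq_self (hM : ∀ f, f ∈ S ↔ (∃ n, f = c n) ∨ ∃ i, f = x i)
    (hc : Function.Injective c) (hx : Function.Injective x) (hcx : ∀ n i, c n ≠ x i)
    (h0 : (0 : N.Krat) ∉ S) (hc0 : c 0 = 1) (hcc : ∀ a b, c a * c b = c (a + b))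
    (hsc : ∀ (g : N.piRat) (n : ℕ), g • c n = c n) (hsx : ∀ (g : N.piRat) (i : ι), g • x i = x (ρ g i))
    (hmv : ∀ i : ι, ∃ g : N.piRat, ρ g i ≠ i)
    (hmove : ∀ i j : ι, i ≠ j → ∃ g : N.piRat, ρ g i = i ∧ ρ g j ≠ j)
    (e : CoricPair.Iso (N.coricPairOfSubset S hS) (N.coricPairOfSubset S hS))
    (y : (N.coricPairOfSubset S hS).carrier) : e.toEquiv y = y := by
  have memc : ∀ n, c n ∈ S := fun n => (hM _).2 (Or.inl ⟨n, rfl⟩)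
  -- fixedness is transported by `e` in both directions
  have fix_of : ∀ w : (N.coricPairOfSubset S hS).carrier, (∀ g : N.piRat, g • (w : N.Krat) = w) →
      ∀ g : N.piRat, g • (e.toEquiv w : N.Krat) = e.toEquiv w := by
    intro w hw g
    have h1 : (g • w : (N.coricPairOfSubset S hS).carrier) = w := Subtype.ext (hw g)
    have h2 := e.smul g w
    rw [h1] at h2
    exact (congrArg Subtype.val h2).symm
  have of_fix : ∀ w : (N.coricPairOfSubset S hS).carrier, (∀ g : N.piRat, g • (e.toEquiv w : N.Krat) = e.toEquiv w) →
      ∀ g : N.piRat, g • (w : N.Krat) = w := by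
    intro w hw g
    have h1 : e.toEquiv (g • w) = e.toEquiv w := (e.smul g w).trans (Subtype.ext (hw g))
    exact congrArg Subtype.val (e.toEquiv.injective h1)
  have fixed_eq : ∀ w : (N.coricPairOfSubset S hS).carrier, (∀ g : N.piRat, g • (w : N.Krat) = w) →
      ∃ n, w = ⟨c n, memc n⟩ := by
    intro w hw
    obtain ⟨n, hn⟩ := exists_eq_c_of_fixed c x ρ hM hx hsx hmv w.2 hw
    exact ⟨n, Subtype.ext hn⟩
  -- values of `e` along the ray, read in `K_rat`
  have val_op : ∀ (p : (N.coricPairOfSubset S hS).pm.dom),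
      (e.toEquiv ((N.coricPairOfSubset S hS).pm.op p) : N.Krat) = (e.toEquiv p.1.1 : N.Krat) * e.toEquiv p.1.2 :=
    fun p => congrArg Subtype.val (e.op p)
  -- `e (c 0) = c 0`
  have dom00 : ((⟨c 0, memc 0⟩, ⟨c 0, memc 0⟩) :
      (N.coricPairOfSubset S hS).carrier × (N.coricPairOfSubset S hS).carrier) ∈ (N.coricPairOfSubset S hS).pm.dom := by
    change c 0 * c 0 ∈ S
    rw [hcc]; exact memc _
  have e0 : e.toEquiv ⟨c 0, memc 0⟩ = ⟨c 0, memc 0⟩ := by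
    have hop0 : (N.coricPairOfSubset S hS).pm.op ⟨_, dom00⟩ = ⟨c 0, memc 0⟩ :=
      Subtype.ext (by change c 0 * c 0 = c 0; rw [hcc])
    have hv := val_op ⟨_, dom00⟩
    rw [hop0] at hv
    have hne : (e.toEquiv ⟨c 0, memc 0⟩ : N.Krat) ≠ 0 := fun h => h0 (h ▸ (e.toEquiv ⟨c 0, memc 0⟩).2)
    have h1 : (e.toEquiv ⟨c 0, memc 0⟩ : N.Krat) = 1 :=
      (mul_left_cancel₀ hne (hv.symm.trans (mul_one _).symm)).symm ▸ rfl
    exact Subtype.ext (h1.trans hc0.symm)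
  -- `e (c 1) = c k`, hence `e (c n) = c (k n)`
  obtain ⟨k, hk⟩ := fixed_eq (e.toEquiv ⟨c 1, memc 1⟩) (fix_of _ (fun g => hsc g 1))
  have hn : ∀ n, e.toEquiv ⟨c n, memc n⟩ = ⟨c (k * n), memc (k * n)⟩ := by
    intro n
    induction n with
    | zero => rw [Nat.mul_zero]; exact e0
    | succ n ih =>
      have hdom : ((⟨c 1, memc 1⟩, ⟨c n, memc n⟩) :
          (N.coricPairOfSubset S hS).carrier × (N.coricPairOfSubset S hS).carrier) ∈
          (N.coricPairOfSubset S hS).pm.dom := by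
        change c 1 * c n ∈ S
        rw [hcc]; exact memc _
      have hop1 : (N.coricPairOfSubset S hS).pm.op ⟨_, hdom⟩ = ⟨c (n + 1), memc (n + 1)⟩ :=
        Subtype.ext (by change c 1 * c n = c (n + 1); rw [hcc, Nat.add_comm])
      have hv := val_op ⟨_, hdom⟩
      rw [hop1] at hv
      apply Subtype.ext
      change (e.toEquiv ⟨c (n + 1), memc (n + 1)⟩ : N.Krat) = c (k * (n + 1))
      rw [hv, hk, ih]
      change c k * c (k * n) = c (k * (n + 1))
      rw [hcc, Nat.mul_succ, Nat.add_comm]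
  have hk1 : k = 1 := by
    obtain ⟨w, hw⟩ := e.toEquiv.surjective ⟨c 1, memc 1⟩
    obtain ⟨m, rfl⟩ := fixed_eq w (of_fix w (by rw [hw]; exact fun g => hsc g 1))
    rw [hn] at hw
    exact Nat.eq_one_of_mul_eq_one_right (hc (congrArg Subtype.val hw))
  -- conclusion
  rcases (hM y).1 y.2 with ⟨n, hyn⟩ | ⟨i, hyi⟩
  · have hy : y = ⟨c n, memc n⟩ := Subtype.ext hyn
    rw [hy, hn, hk1, Nat.one_mul]
  · have hy : y = ⟨x i, hyi ▸ y.2⟩ := Subtype.ext hyi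
    -- `e y` is not fixed, so it is some `x j`
    have hnotfix : ¬ ∀ g : N.piRat, g • (e.toEquiv y : N.Krat) = e.toEquiv y := by
      intro hfix
      obtain ⟨m, hm⟩ := exists_eq_c_of_fixed c x ρ hM hx hsx hmv y.2 (of_fix y hfix)
      exact hcx m i (hm.symm.trans hyi)
    rcases (hM _).1 (e.toEquiv y).2 with ⟨m, hm⟩ | ⟨j, hj⟩
    · exact absurd (fun g => by rw [hm]; exact hsc g m) hnotfix
    · by_cases hij : i = j
      · subst hij
        exact Subtype.ext (hj.trans hyi.symm)
      · obtain ⟨g, hgi, hgj⟩ := hmove i j hij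
        have hgy : (g • y : (N.coricPairOfSubset S hS).carrier) = y :=
          Subtype.ext (by change g • (y : N.Krat) = y; rw [hyi, hsx, hgi])
        have h2 := congrArg Subtype.val (e.smul g y)
        rw [hgy] at h2
        change (e.toEquiv y : N.Krat) = g • (e.toEquiv y : N.Krat) at h2
        rw [hj, hsx] at h2
        exact absurd (hx h2).symm hgj

/-- **A Kummer realisation with prescribed values** for a pair of the same shape: in any `π₁^rat`-module `H`
carrying an injective fixed additive ray `z : ℕ → H` (`z a · z b = z (a + b)`) and an injective equivariant family
`v : ι → H` (`g • v i = v (ρ g i)`) with the product-exclusion pattern of `S` (`z n · v i` is a value only for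
`n = 0`; `v i · v j` never is), there is a `CoricPair.KummerRealization` of `coricPairOfSubset S` in `H` with
`κ(c n) = z n` and `κ(x i) = v i` ([IUTchI] §0: "realises the pseudo-monoid structure" = injective, the domain of the
partial multiplication is exactly the set of pairs whose product stays a value, and the operation is the restricted
group law). ([IUTchI] Ex 5.1 (v) p.127) [claim: Mochizuki2012, status: disputed] -/
theorem exists_kummerRealization (hM : ∀ f, f ∈ S ↔ (∃ n, f = c n) ∨ ∃ i, f = x i)
    (hc : Function.Injective c) (hx : Function.Injective x) (hcx : ∀ n i, c n ≠ x i)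
    (hc0 : c 0 = 1) (hcc : ∀ a b, c a * c b = c (a + b))
    (hcxS : ∀ n i, c n * x i ∈ S → n = 0) (hxxS : ∀ i j, x i * x j ∉ S)
    (hsc : ∀ (g : N.piRat) (n : ℕ), g • c n = c n) (hsx : ∀ (g : N.piRat) (i : ι), g • x i = x (ρ g i))
    {H : Type} [CommGroup H] [MulAction N.piRat H] (z : ℕ → H) (v : ι → H)
    (hz : Function.Injective z) (hv : Function.Injective v) (hzv : ∀ n i, z n ≠ v i)
    (hzz : ∀ a b, z a * z b = z (a + b))
    (hzvR : ∀ n i, z n * v i ∈ Set.range z ∪ Set.range v → n = 0)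
    (hvvR : ∀ i j, v i * v j ∉ Set.range z ∪ Set.range v)
    (hgz : ∀ (g : N.piRat) (n : ℕ), g • z n = z n) (hgv : ∀ (g : N.piRat) (i : ι), g • v i = v (ρ g i)) :
    ∃ κ : (N.coricPairOfSubset S hS).KummerRealization H,
      (∀ n (h : c n ∈ S), κ.toFun ⟨c n, h⟩ = z n) ∧ (∀ i (h : x i ∈ S), κ.toFun ⟨x i, h⟩ = v i) := by
  classical
  have memc : ∀ n, c n ∈ S := fun n => (hM _).2 (Or.inl ⟨n, rfl⟩)
  have hz0 : z 0 = 1 := by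
    have h := hzz 0 0
    rw [Nat.add_zero] at h
    exact mul_left_cancel (h.trans (mul_one _).symm)
  let F : (N.coricPairOfSubset S hS).carrier → H := fun w =>
    if h : ∃ n, (w : N.Krat) = c n then z h.choose else if h' : ∃ i, (w : N.Krat) = x i then v h'.choose else 1
  have Fc : ∀ n (h : c n ∈ S), F ⟨c n, h⟩ = z n := by
    intro n h
    have hex : ∃ m, ((⟨c n, h⟩ : (N.coricPairOfSubset S hS).carrier) : N.Krat) = c m := ⟨n, rfl⟩
    have h1 : F ⟨c n, h⟩ = z hex.choose := dif_pos hex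
    rw [h1, ← hc hex.choose_spec]
  have Fx : ∀ i (h : x i ∈ S), F ⟨x i, h⟩ = v i := by
    intro i h
    have hne : ¬ ∃ m, ((⟨x i, h⟩ : (N.coricPairOfSubset S hS).carrier) : N.Krat) = c m :=
      fun ⟨m, hm⟩ => hcx m i hm.symm
    have hex : ∃ j, ((⟨x i, h⟩ : (N.coricPairOfSubset S hS).carrier) : N.Krat) = x j := ⟨i, rfl⟩
    have h1 : F ⟨x i, h⟩ = v hex.choose := (dif_neg hne).trans (dif_pos hex)
    rw [h1, ← hx hex.choose_spec]
  -- every element is `c n` or `x i`, as a subtype element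
  have cases : ∀ w : (N.coricPairOfSubset S hS).carrier,
      (∃ n, w = ⟨c n, memc n⟩) ∨ ∃ i h, w = ⟨x i, h⟩ := by
    intro w
    rcases (hM w).1 w.2 with ⟨n, hn⟩ | ⟨i, hi⟩
    · exact Or.inl ⟨n, Subtype.ext hn⟩
    · exact Or.inr ⟨i, hi ▸ w.2, Subtype.ext hi⟩
  have rangeF : Set.range F = Set.range z ∪ Set.range v := by
    ext h
    constructor
    · rintro ⟨w, rfl⟩
      rcases cases w with ⟨n, rfl⟩ | ⟨i, hi, rfl⟩
      · exact Or.inl ⟨n, (Fc n _).symm⟩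
      · exact Or.inr ⟨i, (Fx i hi).symm⟩
    · rintro (⟨n, rfl⟩ | ⟨i, rfl⟩)
      · exact ⟨⟨c n, memc n⟩, Fc n _⟩
      · by_cases hi : x i ∈ S
        · exact ⟨⟨x i, hi⟩, Fx i hi⟩
        · exact absurd ((hM _).2 (Or.inr ⟨i, rfl⟩)) hi
  refine ⟨⟨F, ⟨?_, ?_, ?_⟩, ?_⟩, Fc, Fx⟩
  · -- injective
    intro w w' hww
    rcases cases w with ⟨n, rfl⟩ | ⟨i, hi, rfl⟩ <;> rcases cases w' with ⟨m, rfl⟩ | ⟨j, hj, rfl⟩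
    · rw [Fc, Fc] at hww; cases hz hww; rfl
    · rw [Fc, Fx] at hww; exact absurd hww (hzv n j)
    · rw [Fx, Fc] at hww; exact absurd hww.symm (hzv m i)
    · rw [Fx, Fx] at hww; exact Subtype.ext (congrArg x (hv hww))
  · -- the domain is exactly the set of pairs whose product stays a value
    ext p
    obtain ⟨w, w'⟩ := p
    change (w : N.Krat) * w' ∈ S ↔ F w * F w' ∈ Set.range F
    rw [rangeF]
    rcases cases w with ⟨n, rfl⟩ | ⟨i, hi, rfl⟩ <;> rcases cases w' with ⟨m, rfl⟩ | ⟨j, hj, rfl⟩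
    · rw [Fc, Fc]
      change c n * c m ∈ S ↔ _
      rw [hcc, hzz]
      exact ⟨fun _ => Or.inl ⟨_, rfl⟩, fun _ => memc _⟩
    · rw [Fc, Fx]
      change c n * x j ∈ S ↔ _
      constructor
      · intro h
        rw [hcxS n j h, hz0, one_mul]; exact Or.inr ⟨j, rfl⟩
      · intro h
        rw [hzvR n j h, hc0, one_mul]; exact hj
    · rw [Fx, Fc]
      change x i * c m ∈ S ↔ _
      rw [mul_comm (x i), mul_comm (v i)]
      constructor
      · intro h
        rw [hcxS m i h, hz0, one_mul]; exact Or.inr ⟨i, rfl⟩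
      · intro h
        rw [hzvR m i h, hc0, one_mul]; exact hi
    · rw [Fx, Fx]
      change x i * x j ∈ S ↔ _
      exact ⟨fun h => absurd h (hxxS i j), fun h => absurd h (hvvR i j)⟩
  · -- the operation is the restricted group law
    intro p
    obtain ⟨⟨w, w'⟩, hp⟩ := p
    change F ⟨(w : N.Krat) * w', hp⟩ = F w * F w'
    rcases cases w with ⟨n, rfl⟩ | ⟨i, hi, rfl⟩ <;> rcases cases w' with ⟨m, rfl⟩ | ⟨j, hj, rfl⟩
    · have h1 : (⟨c n * c m, hp⟩ : (N.coricPairOfSubset S hS).carrier) = ⟨c (n + m), memc _⟩ :=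
        Subtype.ext (hcc n m)
      rw [h1, Fc, Fc, Fc, hzz]
    · have hn0 : n = 0 := hcxS n j hp
      subst hn0
      have h1 : (⟨c 0 * x j, hp⟩ : (N.coricPairOfSubset S hS).carrier) = ⟨x j, hj⟩ :=
        Subtype.ext (by change c 0 * x j = x j; rw [hc0, one_mul])
      rw [h1, Fx, Fc, hz0, one_mul]
    · have hm0 : m = 0 := hcxS m i (by rw [mul_comm]; exact hp)
      subst hm0
      have h1 : (⟨x i * c 0, hp⟩ : (N.coricPairOfSubset S hS).carrier) = ⟨x i, hi⟩ :=
        Subtype.ext (by change x i * c 0 = x i; rw [hc0, mul_one])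
      rw [h1, Fx, Fc, hz0, mul_one]
    · exact absurd hp (hxxS i j)
  · -- equivariance
    intro g w
    rcases cases w with ⟨n, rfl⟩ | ⟨i, hi, rfl⟩
    · have h1 : (g • (⟨c n, memc n⟩ : (N.coricPairOfSubset S hS).carrier)) = ⟨c n, memc n⟩ :=
        Subtype.ext (hsc g n)
      rw [h1, Fc, hgz]
    · have h1 : (g • (⟨x i, hi⟩ : (N.coricPairOfSubset S hS).carrier)) = ⟨x (ρ g i), (hsx g i) ▸ hS g hi⟩ :=
        Subtype.ext (hsx g i)
      rw [h1, Fx, Fx, hgv]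

end CoricLawsToy

end NFBridgeRecon

end Literature.IUT.HodgeTheaters
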